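import Mathlib
import HarnessLib
import Literature.MathematicalPhysics.KineticTheory.HardSphereEuler
import Literature.MathematicalPhysics.KineticTheory.BackwardCluster
import Literature.MathematicalPhysics.KineticTheory.HardSphereDisplacementPathLength
import Summits.AtomisticToContinuum.HydrodynamicLimit.Theorems.RelayRaceLocalityGibbsLightConeLinkCountBridge
import Summits.AtomisticToContinuum.HydrodynamicLimit.Theorems.RelayRaceLocalityGibbsLightConeStubLinkCountTail
import Summits.AtomisticToContinuum.HydrodynamicLimit.Theorems.RelayRaceLocalityGibbsLightConeLinkGlue
import Summits.AtomisticToContinuum.HydrodynamicLimit.Theorems.RelayRaceLocalityGibbsLightConeHotGlue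

/-!
# Glue `L″` of the line `Sketch` for the crux `RelayRaceLocality.GibbsLightCone`
(stmt-AtomisticToContinuum-12501): the slab-contact necklace bound implies the link-count tail

Helper file (`--supports stmt-AtomisticToContinuum-12501`). The registered stub
`stub_linkCountTail_of_slabContactNecklaceBound` (GLUE L″, skeleton revision 10) is the
deterministic / combinatorial reduction of the LINK-COUNT TAIL (some simple collision chain into the
tagged particle over the window `[0, M τ_N]` has more than `λ M / σ³` links with probability
`≤ C e^{-cM}`) to the SLAB-CONTACT NECKLACE BOUND `X″` (for an injective label sequence
`q 0 … q n`, nondecreasing slab times `T 1 ≤ … ≤ T n` in the window and a slab width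
`Δ ≤ ε_N/√θ`, the Gibbs probability that EVERY consecutive pair `q m, q (m+1)` is in contact at
SOME time of its slab `[T (m+1), T (m+1) + Δ]` is `≤ (C₁ (ε_N + Λ√θΔ)³)ⁿ`), through the landed
first-moment bridge `linkCountTail_of_simpleChainCountBound` (`…LinkCountBridge.lean`). It is the
glue `L` of revision 8 (`stub_linkCountTail_of_spaceTimeNecklaceBound`, `…LinkGlue.lean`) with a
simpler slabbing step:

* SLABBING (`exists_slabMap_necklace_sandwich_of_chain`, `…HotGlue.lean`): a chain with link times
  `T 1 ≤ … ≤ T n` in `[0, W]` has, at mesh `Δ`, nondecreasing slab times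
  `T' (m+1) = ⌊T (m+1)/Δ⌋ Δ` with the SANDWICH `T' j ≤ T j ≤ T' j + Δ`, so the true link time
  `T (m+1)` itself witnesses a contact of `q m, q (m+1)` during the slab `[T' (m+1), T' (m+1) + Δ]`;
  the slab map `m ↦ ⌊T (m+1)/Δ⌋ ∈ {0, …, ⌊W/Δ⌋}` is monotone;
* COUNTING (`card_filter_monotone_le_choose`) and ARITHMETIC (`choose_mul_pow_le_exp_mul_pow`) as
  in glue `L`: mesh `Δ = ε_N/(Λ√θ)` (so `ε_N + Λ√θΔ = 2ε_N`, `W/Δ = ΛM/σ³`), union over the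
  `(N+1)ⁿ` label sequences ending at `p` and the `≤ C(m+n, n)` monotone slab maps, `(N+1) ε_N³ = σ³`
  (`succ_mul_hsDiameter_pow_three`), the bad set is null: `Σ_q G ≤ C(m+n,n) (8C₁σ³)ⁿ ≤
  e^{16 C₁ Λ M} (3/4)ⁿ` once `32 C₁ σ³ ≤ 1`, the first-moment hypothesis of the bridge with
  `C₀ = 1`, `c₁ = 16 C₁ Λ`, `ρ = 3/4` (here `C₁` stands for `|C₁| + 1`).

The necklace bound `X″` itself is NOT proved here: it is the hypothesis of the glue (the open seam
of the line).
-/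

namespace Summit.AtomisticToContinuum.HydrodynamicLimit.Theorems.LogWindowTaggedTail

open Literature.MathematicalPhysics.KineticTheory Literature.Analysis.FluidPDE MeasureTheory Filter Set

open scoped ENNReal

/-- **GLUE L″** (registered stub `stub_linkCountTail_of_slabContactNecklaceBound` of the line
`Sketch`, skeleton revision 10): the slab-contact necklace bound `X″` implies the registered
link-count tail. Slabbing at mesh `Δ = ε_N/(Λ√θ)` with the sandwich
(`exists_slabMap_necklace_sandwich_of_chain`: the slab of a link time contains the link time, which
witnesses the contact), union over the `(N+1)ⁿ` label sequences ending at the tagged particle and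
the `≤ C(m+n, n)` monotone slab maps (`card_filter_monotone_le_choose`, `m = ⌊ΛM/σ³⌋`),
`(N+1) ε_N³ = σ³`, the null bad set, and the arithmetic `C(m+n,n) (8C₁σ³)ⁿ ≤ e^{16C₁ΛM} (3/4)ⁿ`
for `32 C₁ σ³ ≤ 1` (`choose_mul_pow_le_exp_mul_pow`) give the first-moment hypothesis of the landed
bridge `linkCountTail_of_simpleChainCountBound` with `C₀ = 1`, `c₁ = 16C₁Λ`, `ρ = 3/4`.
[folklore] -/
theorem stub_linkCountTail_of_slabContactNecklaceBound :
    (∀ a θ : ℝ, 0 < a → 0 < θ → ∃ σ₀ : ℝ, 0 < σ₀ ∧ ∃ C₁ Λ : ℝ, 1 ≤ Λ ∧ ∀ K : ℝ, 0 < K →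
        ∀ σ : ℝ, 0 < σ → σ < σ₀ →
        ∀ Φ : (N : ℕ) → HardSphereFlow (Torus.geometry (Fin 3)) (hsDiameter σ N) (N + 1),
        ∀ᶠ N : ℕ in atTop, ∀ M : ℝ, 1 ≤ M → M ≤ K * Real.log ((N : ℝ) + 2) →
          ∀ Δ : ℝ, 0 < Δ → Δ ≤ hsDiameter σ N / Real.sqrt θ →
          ∀ (n : ℕ) (q : Fin (n + 1) → Fin (N + 1)) (T : Fin (n + 2) → ℝ),
            Function.Injective q → Monotone T → T 0 = 0 →
            T (Fin.last (n + 1)) = M * (((N + 1 : ℕ) : ℝ) ^ (-(1 / 3 : ℝ)) / σ ^ 2 / Real.sqrt θ) →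
          localGibbsLaw σ (fun _ => a) (fun _ => 0) (fun _ => θ) N (Φ N)
            {z | ∀ m : Fin n, ∃ u ∈ Set.Icc (T (Fin.castSucc (Fin.succ m))) (T (Fin.castSucc (Fin.succ m)) + Δ),
                s(q (Fin.castSucc m), q (Fin.succ m)) ∈
                  contactPairSet (Torus.geometry (Fin 3)) (hsDiameter σ N) ((Φ N).flow u z)}
            ≤ ENNReal.ofReal ((C₁ * (hsDiameter σ N + Λ * Real.sqrt θ * Δ) ^ 3) ^ n)) →
    ∀ a θ : ℝ, 0 < a → 0 < θ → ∃ σ₀ : ℝ, 0 < σ₀ ∧ ∃ lam c C : ℝ, 0 < c ∧ ∀ K : ℝ, 0 < K →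
      ∀ σ : ℝ, 0 < σ → σ < σ₀ →
      ∀ Φ : (N : ℕ) → HardSphereFlow (Torus.geometry (Fin 3)) (hsDiameter σ N) (N + 1),
      ∀ᶠ N in atTop, ∀ p : Fin (N + 1), ∀ M : ℝ, 1 ≤ M → M ≤ K * Real.log ((N : ℝ) + 2) →
        localGibbsLaw σ (fun _ => a) (fun _ => 0) (fun _ => θ) N (Φ N)
          {z | ∃ (k : ℕ) (q : Fin (k + 1) → Fin (N + 1)) (T : Fin (k + 2) → ℝ),
              q (Fin.last k) = p ∧ Function.Injective q ∧ Monotone T ∧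
              StrictMono (fun m : Fin k => T (Fin.castSucc (Fin.succ m))) ∧ T 0 = 0 ∧
              T (Fin.last (k + 1)) = M * (((N + 1 : ℕ) : ℝ) ^ (-(1 / 3 : ℝ)) / σ ^ 2 / Real.sqrt θ) ∧
              (∀ m : Fin k, s(q (Fin.castSucc m), q (Fin.succ m)) ∈
                contactPairSet (Torus.geometry (Fin 3)) (hsDiameter σ N)
                  ((Φ N).flow (T (Fin.castSucc (Fin.succ m))) z)) ∧
              lam * M * (((N + 1 : ℕ) : ℝ) ^ (-(1 / 3 : ℝ)) / σ ^ 2) < k * hsDiameter σ N}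
          ≤ ENNReal.ofReal (C * Real.exp (-c * M)) := by
  -- adapted from `stub_linkCountTail_of_spaceTimeNecklaceBound` (glue `L`, `…LinkGlue.lean`)
  intro hX
  refine linkCountTail_of_simpleChainCountBound fun a θ ha hθ => ?_
  obtain ⟨σ₁, hσ₁, C₁, Λ, hΛ, H⟩ := hX a θ ha hθ
  -- constants, all fixed before `σ`
  have hΛ0 : 0 < Λ := one_pos.trans_le hΛ
  set C : ℝ := |C₁| + 1 with hC
  have hC0 : 0 < C := by positivity
  have hC1 : |C₁| ≤ C := by rw [hC]; linarith
  refine ⟨min σ₁ (min 1 (1 / (32 * C))), lt_min hσ₁ (lt_min one_pos (by positivity)), 1,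
    16 * C * Λ, 3 / 4, by norm_num, by norm_num, ?_⟩
  intro K hK σ hσ hσlt Φ
  have hσσ₁ : σ < σ₁ := lt_of_lt_of_le hσlt (min_le_left _ _)
  have hσ1 : σ ≤ 1 := (lt_of_lt_of_le hσlt ((min_le_right _ _).trans (min_le_left _ _))).le
  have hσC : σ ≤ 1 / (32 * C) :=
    (lt_of_lt_of_le hσlt ((min_le_right _ _).trans (min_le_right _ _))).le
  have hx : 8 * C * σ ^ 3 ≤ 1 / 4 := by
    have h3 : σ ^ 3 ≤ σ := pow_le_of_le_one hσ.le hσ1 (by norm_num)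
    have h4 : σ * (32 * C) ≤ 1 := by rwa [le_div_iff₀ (by positivity)] at hσC
    nlinarith [mul_le_mul_of_nonneg_left h3 (by positivity : (0 : ℝ) ≤ 8 * C)]
  have hx0 : 0 ≤ 8 * C * σ ^ 3 := by positivity
  filter_upwards [H K hK σ hσ hσσ₁ Φ] with N hN p M hM hMK n
  -- units: `ε = σ ν`, `W = M ν / (σ² √θ)`, mesh `Δ = ε / (Λ √θ)`, `m = ⌊W / Δ⌋ = ⌊Λ M / σ³⌋`
  have hε : 0 < hsDiameter σ N := hsDiameter_pos hσ N
  have hsq : 0 < Real.sqrt θ := Real.sqrt_pos.2 hθ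
  have hM0 : 0 ≤ M := by linarith
  have hgood0 : localGibbsLaw σ (fun _ => a) (fun _ => 0) (fun _ => θ) N (Φ N) (Φ N).goodᶜ = 0 := by
    unfold localGibbsLaw particleLaw
    exact withDensity_absolutelyContinuous _ _ (Φ N).measure_compl_good
  set ν : ℝ := ((N + 1 : ℕ) : ℝ) ^ (-(1 / 3 : ℝ)) with hν
  have hνpos : 0 < ν := Real.rpow_pos_of_pos (by positivity) _
  have hεν : hsDiameter σ N = σ * ν := rfl
  set W : ℝ := M * (ν / σ ^ 2 / Real.sqrt θ) with hW
  set Δ : ℝ := hsDiameter σ N / (Λ * Real.sqrt θ) with hΔdef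
  have hΔ : 0 < Δ := div_pos hε (mul_pos hΛ0 hsq)
  have hΔle : Δ ≤ hsDiameter σ N / Real.sqrt θ := by
    rw [hΔdef, mul_comm, ← div_div]
    exact div_le_self (div_nonneg hε.le hsq.le) hΛ
  have hΛΔ : Λ * Real.sqrt θ * Δ = hsDiameter σ N := by
    rw [hΔdef]
    field_simp
  have hWΔ : W / Δ = Λ * M / σ ^ 3 := by
    rw [hW, hΔdef, hεν]
    field_simp
  set m : ℕ := ⌊W / Δ⌋₊ with hm
  have hmle : (m : ℝ) ≤ Λ * M / σ ^ 3 := by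
    rw [hm, ← hWΔ]
    exact Nat.floor_le (div_nonneg (by positivity) hΔ.le)
  set P := localGibbsLaw σ (fun _ => a) (fun _ => 0) (fun _ => θ) N (Φ N) with hP
  -- the real per-necklace bound `R = (C (2ε)³)ⁿ ≥ (C₁ (ε + Λ√θΔ)³)ⁿ`
  set R : ℝ := (C * (2 * hsDiameter σ N) ^ 3) ^ n with hR
  have hXR : (C₁ * (hsDiameter σ N + Λ * Real.sqrt θ * Δ) ^ 3) ^ n ≤ R := by
    rw [hΛΔ, ← two_mul, hR]
    calc (C₁ * (2 * hsDiameter σ N) ^ 3) ^ n ≤ |(C₁ * (2 * hsDiameter σ N) ^ 3) ^ n| :=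
          le_abs_self _
      _ = (|C₁| * (2 * hsDiameter σ N) ^ 3) ^ n := by
          rw [abs_pow, abs_mul, abs_of_nonneg (by positivity : (0 : ℝ) ≤ (2 * hsDiameter σ N) ^ 3)]
      _ ≤ (C * (2 * hsDiameter σ N) ^ 3) ^ n :=
          pow_le_pow_left₀ (by positivity) (mul_le_mul_of_nonneg_right hC1 (by positivity)) n
  have hR0 : 0 ≤ R := by positivity
  -- the slab-contact necklace events, indexed by the label sequence and the slab map
  obtain ⟨B, hB⟩ : ∃ B : (Fin (n + 1) → Fin (N + 1)) → (Fin n → Fin (m + 1)) →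
      Set (Config (N + 1) (Fin 3) T3), ∀ q w, B q w =
        {z | ∃ T' : Fin (n + 2) → ℝ, Monotone T' ∧ T' 0 = 0 ∧ T' (Fin.last (n + 1)) = W ∧
          (∀ m' : Fin n, T' (Fin.castSucc (Fin.succ m')) = ((w m' : ℕ) : ℝ) * Δ) ∧
          ∀ m' : Fin n, ∃ u ∈ Set.Icc (T' (Fin.castSucc (Fin.succ m')))
              (T' (Fin.castSucc (Fin.succ m')) + Δ),
            s(q (Fin.castSucc m'), q (Fin.succ m')) ∈
              contactPairSet (Torus.geometry (Fin 3)) (hsDiameter σ N) ((Φ N).flow u z)} :=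
    ⟨_, fun _ _ => rfl⟩
  -- `X″` bounds each slab-contact necklace event of an injective label sequence
  have hper : ∀ q : Fin (n + 1) → Fin (N + 1), Function.Injective q →
      ∀ w : Fin n → Fin (m + 1), P (B q w) ≤ ENNReal.ofReal R := by
    intro q hinj w
    by_cases hex : ∃ T' : Fin (n + 2) → ℝ, Monotone T' ∧ T' 0 = 0 ∧ T' (Fin.last (n + 1)) = W ∧
        ∀ m' : Fin n, T' (Fin.castSucc (Fin.succ m')) = ((w m' : ℕ) : ℝ) * Δ
    · obtain ⟨T₀, hT₀m, hT₀0, hT₀W, hT₀s⟩ := hex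
      refine (measure_mono ?_).trans
        ((hN M hM hMK Δ hΔ hΔle n q T₀ hinj hT₀m hT₀0 hT₀W).trans (ENNReal.ofReal_le_ofReal hXR))
      intro z hz
      rw [hB] at hz
      obtain ⟨T', -, hT'0, hT'W, hT's, hz⟩ := hz
      have heq : T' = T₀ :=
        slabTimes_eq_of_eq (hT'0.trans hT₀0.symm) (hT'W.trans hT₀W.symm)
          fun m' => (hT's m').trans (hT₀s m').symm
      rw [heq] at hz
      exact hz
    · refine Eq.trans_le (measure_mono_null (fun z hz => ?_) measure_empty) zero_le
      rw [hB] at hz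
      obtain ⟨T', h1, h2, h3, h4, -⟩ := hz
      exact (hex ⟨T', h1, h2, h3, h4⟩).elim
  -- monotone slab maps and label sequences ending at `p`
  set S : Finset (Fin n → Fin (m + 1)) := Finset.univ.filter Monotone with hS
  have hScard : (S.card : ℝ≥0∞) ≤ (((m + n).choose n : ℕ) : ℝ≥0∞) := by
    exact_mod_cast card_filter_monotone_le_choose n m
  have hcardF : (Finset.univ.filter fun q : Fin (n + 1) → Fin (N + 1) => q (Fin.last n) = p).card ≤
      (N + 1) ^ n := by
    have h := Finset.card_le_card_of_injOn
      (s := Finset.univ.filter fun q : Fin (n + 1) → Fin (N + 1) => q (Fin.last n) = p)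
      (t := (Finset.univ : Finset (Fin n → Fin (N + 1)))) (fun q i => q (Fin.castSucc i))
      (fun _ _ => Finset.mem_coe.2 (Finset.mem_univ _)) ?_
    · rwa [Finset.card_univ, Fintype.card_fun, Fintype.card_fin, Fintype.card_fin] at h
    · intro q₁ hq₁ q₂ hq₂ h
      have h₁ : q₁ (Fin.last n) = p := (Finset.mem_filter.1 (Finset.mem_coe.1 hq₁)).2
      have h₂ : q₂ (Fin.last n) = p := (Finset.mem_filter.1 (Finset.mem_coe.1 hq₂)).2
      funext j
      refine Fin.lastCases ?_ (fun i => ?_) j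
      · rw [h₁, h₂]
      · exact congr_fun h i
  -- union bound over the label sequences ending at `p` …
  refine (Finset.sum_le_sum (g := fun q => if q (Fin.last n) = p then
    (((m + n).choose n : ℕ) : ℝ≥0∞) * ENNReal.ofReal R else 0) fun q _ => ?_).trans ?_
  · by_cases hqp : q (Fin.last n) = p
    · rw [if_pos hqp]
      by_cases hinj : Function.Injective q
      · -- … over the null bad set and the monotone slab maps
        refine (measure_mono (t := (Φ N).goodᶜ ∪ ⋃ w ∈ S, B q w) ?_).trans ?_
        · intro z hz
          by_cases hzg : z ∈ (Φ N).good
          · obtain ⟨-, -, T, hTm, -, hT0, hTW, hlink⟩ := hz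
            -- SLABBING with the sandwich: the true link time lies in its slab and is the witness
            obtain ⟨w, T', hw, hT'm, hT'0, hT'W, hT's, hTT', -⟩ :=
              exists_slabMap_necklace_sandwich_of_chain (Φ N) hzg hΔ q T hTm hT0 hTW hlink
            refine Or.inr (Set.mem_iUnion₂.2 ⟨w, Finset.mem_filter.2 ⟨Finset.mem_univ _, hw⟩, ?_⟩)
            rw [hB]
            exact ⟨T', hT'm, hT'0, hT'W, hT's, fun m' =>
              ⟨T (Fin.castSucc (Fin.succ m')), ⟨(hTT' _).1, (hTT' _).2⟩, hlink m'⟩⟩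
          · exact Or.inl hzg
        · refine (measure_union_le _ _).trans ?_
          rw [hgood0, zero_add]
          refine (measure_biUnion_finset_le S (B q)).trans ?_
          refine (Finset.sum_le_card_nsmul _ _ (ENNReal.ofReal R) fun w _ => hper q hinj w).trans ?_
          rw [nsmul_eq_mul]
          exact mul_le_mul_left hScard _
      · refine Eq.trans_le (measure_mono_null (fun z hz => ?_) measure_empty) zero_le
        exact (hinj hz.2.1).elim
    · rw [if_neg hqp]
      refine le_of_eq (measure_mono_null (fun z hz => ?_) measure_empty)
      exact (hqp hz.1).elim
  · -- the arithmetic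
    rw [Finset.sum_ite, Finset.sum_const_zero, add_zero, Finset.sum_const, nsmul_eq_mul]
    refine (mul_le_mul_left (show ((Finset.univ.filter fun q : Fin (n + 1) → Fin (N + 1) =>
      q (Fin.last n) = p).card : ℝ≥0∞) ≤ (((N + 1) ^ n : ℕ) : ℝ≥0∞) by exact_mod_cast hcardF)
      _).trans ?_
    have hconv : ENNReal.ofReal ((((N + 1) ^ n : ℕ) : ℝ) * ((((m + n).choose n : ℕ) : ℝ) * R)) =
        (((N + 1) ^ n : ℕ) : ℝ≥0∞) * ((((m + n).choose n : ℕ) : ℝ≥0∞) * ENNReal.ofReal R) := by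
      rw [ENNReal.ofReal_mul (by positivity), ENNReal.ofReal_mul (by positivity),
        ENNReal.ofReal_natCast, ENNReal.ofReal_natCast]
    rw [← hconv]
    refine ENNReal.ofReal_le_ofReal ?_
    have hσ3 : ((N + 1 : ℕ) : ℝ) * hsDiameter σ N ^ 3 = σ ^ 3 := succ_mul_hsDiameter_pow_three σ N
    have hNR : (((N + 1) ^ n : ℕ) : ℝ) * R = (8 * C * σ ^ 3) ^ n := by
      rw [hR, Nat.cast_pow, ← mul_pow, ← hσ3]
      ring
    have key := choose_mul_pow_le_exp_mul_pow hx0 hx m n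
    have hexp : Real.exp (2 * (8 * C * σ ^ 3) * m) ≤ Real.exp (16 * C * Λ * M) := by
      refine Real.exp_le_exp.2 ?_
      have h1 : σ ^ 3 * (m : ℝ) ≤ Λ * M := by
        calc σ ^ 3 * (m : ℝ) ≤ σ ^ 3 * (Λ * M / σ ^ 3) :=
              mul_le_mul_of_nonneg_left hmle (by positivity)
          _ = Λ * M := by field_simp
      nlinarith [h1, hC0]
    calc (((N + 1) ^ n : ℕ) : ℝ) * ((((m + n).choose n : ℕ) : ℝ) * R)
        = (((m + n).choose n : ℕ) : ℝ) * ((((N + 1) ^ n : ℕ) : ℝ) * R) := by ring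
      _ = (((m + n).choose n : ℕ) : ℝ) * (8 * C * σ ^ 3) ^ n := by rw [hNR]
      _ ≤ Real.exp (2 * (8 * C * σ ^ 3) * m) * (3 / 4) ^ n := key
      _ ≤ Real.exp (16 * C * Λ * M) * (3 / 4) ^ n :=
          mul_le_mul_of_nonneg_right hexp (by positivity)
      _ = 1 * Real.exp (16 * C * Λ * M) * (3 / 4) ^ n := by rw [one_mul]

end Summit.AtomisticToContinuum.HydrodynamicLimit.Theorems.LogWindowTaggedTail
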